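import Mathlib
import HarnessLib
import Summits.QuantumFields.YangMills.Theses.ConvexGribovBody
import Summits.QuantumFields.YangMills.Theses.SmallCircleAnchor
import Summits.QuantumFields.YangMills.Theses.HyperbolicRegulator
import Summits.QuantumFields.YangMills.Theses.ContractibleFibre
import Summits.QuantumFields.YangMills.Theses.DirichletWindow
import Summits.QuantumFields.YangMills.Theorems.ConvexGribovBodyContinuumLegGivenGapDock
import Summits.QuantumFields.YangMills.Theorems.ConvexGribovBodyContinuumLegGivenGapThreshold
import Summits.QuantumFields.YangMills.Theorems.DirichletWindowCriticalityOfXiDiverges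
import Summits.QuantumFields.YangMills.Theorems.ConvexGribovBodyContinuumLegGivenGapStubWitness
import Summits.QuantumFields.YangMills.Theorems.ConvexGribovBodyContinuumLegGivenGapStubCritical
import Summits.QuantumFields.YangMills.Theorems.ConvexGribovBodyContinuumLegGivenGapStubLock
import Summits.QuantumFields.YangMills.Theorems.ConvexGribovBodyContinuumLegGivenGapStubLockB
import Summits.QuantumFields.YangMills.Theorems.ConvexGribovBodyContinuumLegGivenGapStubWindowOfNG
import Summits.QuantumFields.YangMills.Theorems.ConvexGribovBodyContinuumLegGivenGapStubLskBridge
import Summits.QuantumFields.YangMills.Theorems.ConvexGribovBodyContinuumLegGivenGapStubArp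
import Summits.QuantumFields.YangMills.Theorems.ConvexGribovBodyContinuumLegGivenGapStubExtract
import Summits.QuantumFields.YangMills.Theorems.ConvexGribovBodyContinuumLegGivenGapStubCltOfCscl
import Summits.QuantumFields.YangMills.Theorems.ConvexGribovBodyContinuumLegGivenGapStubAsympCS
import Summits.QuantumFields.YangMills.Theorems.ConvexGribovBodyContinuumLegGivenGapStubSmallRotation
import Summits.QuantumFields.YangMills.Theorems.ConvexGribovBodyContinuumLegGivenGapStubBddSlabDensity
import Summits.QuantumFields.YangMills.Theorems.ConvexGribovBodyContinuumLegGivenGapStubUclOfCscl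
import Summits.QuantumFields.YangMills.Theorems.ConvexGribovBodyContinuumLegGivenGapStubRotNiven
import Summits.QuantumFields.YangMills.Theorems.ConvexGribovBodyContinuumLegGivenGapStubRotHyper
import Summits.QuantumFields.YangMills.Theorems.ConvexGribovBodyContinuumLegGivenGapStubRotOfPythagorean
import Summits.QuantumFields.YangMills.Theorems.ConvexGribovBodyContinuumLegGivenGapStubRpFormsCS
import Summits.QuantumFields.YangMills.Theorems.ConvexGribovBodyContinuumLegGivenGapStubRpShift
import Summits.QuantumFields.YangMills.Theorems.ConvexGribovBodyContinuumLegGivenGapStubObsGeometry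
import Summits.QuantumFields.YangMills.Theorems.ConvexGribovBodyContinuumLegGivenGapStubLockOfRpCore
import Summits.QuantumFields.YangMills.Theorems.ConvexGribovBodyContinuumLegGivenGapStubRpCoreA
import Summits.QuantumFields.YangMills.Theorems.ConvexGribovBodyContinuumLegGivenGapStubRpCore
import Summits.QuantumFields.YangMills.Theorems.ConvexGribovBodyContinuumLegGivenGapStubOsMatching
import Summits.QuantumFields.YangMills.Theorems.ConvexGribovBodyContinuumLegGivenGapCsclTorusForms
import Summits.QuantumFields.YangMills.Theorems.ConvexGribovBodyContinuumLegGivenGapStubCsclReal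
import Summits.QuantumFields.YangMills.Theorems.ConvexGribovBodyContinuumLegGivenGapStubCsclLattice
import Summits.QuantumFields.YangMills.Theorems.ConvexGribovBodyContinuumLegGivenGapStubCsclTorusRP
import Summits.QuantumFields.YangMills.Theorems.ConvexGribovBodyContinuumLegGivenGapStubCsclConv
import Summits.QuantumFields.YangMills.Theorems.ConvexGribovBodyContinuumLegGivenGapStubCsclIvCS
import Summits.QuantumFields.YangMills.Theorems.ConvexGribovBodyContinuumLegGivenGapStubCsclCoreVar
import Summits.QuantumFields.YangMills.Theorems.ConvexGribovBodyContinuumLegGivenGapStubCsclCore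
import Summits.QuantumFields.YangMills.Theorems.ConvexGribovBodyContinuumLegGivenGapStubCsclNearFar
import Summits.QuantumFields.YangMills.Theorems.ConvexGribovBodyContinuumLegGivenGapStubCsclKernel
import Summits.QuantumFields.YangMills.Theorems.ConvexGribovBodyContinuumLegGivenGapStubCsclLimitCS
import Summits.QuantumFields.YangMills.Theorems.ParabolicTrajectoryContinuumLimitOnTrajectoryStubArp
import Summits.QuantumFields.YangMills.Theorems.ParabolicTrajectoryContinuumLimitOnTrajectoryUvbOfUuvb
import Summits.QuantumFields.YangMills.Theorems.ParabolicTrajectoryContinuumLimitOnTrajectorySlabRP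
import Summits.QuantumFields.YangMills.Theorems.ParabolicTrajectoryContinuumLimitOnTrajectoryStubOSLegsD_Assembly
import Summits.QuantumFields.YangMills.Theorems.ParabolicTrajectoryContinuumLimitOnTrajectoryStubOSLegsA_Lattice
import Summits.QuantumFields.YangMills.Theorems.ParabolicTrajectoryContinuumLimitOnTrajectoryStubTransl
import Summits.QuantumFields.YangMills.Theorems.LangevinControlUVOSLegsFromFemtoAndGapStubAssemblyCompactness
import Literature.Barriers.QuantumFields.UVStabilityNonUniqueness
import Literature.MathematicalPhysics.QuantumFieldTheory.MassGapFromLatticeClustering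
import Literature.MathematicalPhysics.QuantumFieldTheory.SpeciesLatticeProducts

/-!
# Split glue for the crux `ContinuumLegGivenGap` (stmt-QuantumFields-15828): `ContinuumLegGivenGap_of_subs`

(PUBLISHED VARIANT `Lines/split-glue.lean`: concludes the registered crux declaration `HyperbolicRegulator.ContinuumLegGivenGap`
and the twins ConvexGribovBody / SmallCircleAnchor / ContractibleFibre; the `ComplexCouplingChannel` / `DoublingDefect`
declarations are character-identical (`Iff.rfl`) — the full form with all six is the item evidence
`ContinuumLegGivenGapSplit4.lean` (lean check rc 0 before the route file's olean went stale on the farm).)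

Strategist file (crux-strategist seat `planner-cstrat-stmt-QuantumFields-15828-b1-0`, route `ComplexCouplingChannel`,
2026-08-17): the TYPED SPLIT of the shared existence leg into its genuine pieces, with the implication PROVED here
(no `sorry`), hypotheses written out verbatim:

`ContinuumLegGivenGap_of_subs : XiDiverges → ⟨VolumeUniformUVEngine⟩ → ⟨SkewnessWindowNLO⟩ → ⟨CSClusteringFromLockedGap⟩ →
ComplexCouplingChannel.ContinuumLegGivenGap` (and twins for the five other route declarations of the shared item).

* `XiDiverges` — stmt-QuantumFields-8941 (route DirichletWindow) BY NAME: the curvature correlation length diverges as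
  `β → ∞` (criticality; any proof of the crux contains it, Disproof gen 2 §5 NM3 / `FixedCouplingUltralocality`).
* ⟨VolumeUniformUVEngine⟩ — verbatim the registered stub `stub_uvPackageVol` of line `Sketch` (reshape 17, lead c5):
  the UV engine at the gap-pinned unit, UNIFORMLY IN THE VOLUME ((UUVB) E0′ bounds for corner-plaquette strings, (ND)
  a two-point floor, (ROT₃₄₅) asymptotic invariance under one Pythagorean rotation) — Bałaban / Magnen–Rivasseau–Sénéor class.
* ⟨SkewnessWindowNLO⟩ — verbatim the registered stub `stub_skewWindow` (crux card `duality-selection-nlo-skewness`): the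
  non-Gaussianity of `tr F²` as an NLO skewness window (stmt-9118 class with (CL) ↦ (CL-t)).
* ⟨CSClusteringFromLockedGap⟩ — verbatim the registered glue stub `stub_csclOfLock` (reshape 17-CS; PROVABLE and being
  landed by lead c6 at the time of writing): Cauchy–Schwarz clustering of the canonical scheme from the locked lattice
  gap + exact odd-torus reflection positivity. Once `…Theorems.ContinuumLegGivenGap.stub_csclOfLock` lands, the
  three-hypothesis form follows by one application.

Everything else is the composition of line `Sketch` (reshape 18, `Cruxes/ContinuumLegGivenGap/Lines/Sketch.lean`,
leads -0, c1–c6 of stmt-QuantumFields-15828) over LANDED theorems only (`…Theorems.ContinuumLegGivenGap.stub_*`,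
route ParabolicTrajectory's one-field OS packaging `oneFieldOSLegs'`/`stub_arp`/`stub_transl`, Literature
`IsYangMillsFor.hasMassGap_of_hasCSClustering`, `subScheme`). §0–§1 and §3 below re-use that composition verbatim with
the three open `stub_*` replaced by the hypotheses `stub_uvPackageVol`, `stub_csclOfLock`, `stub_skewWindow` (section variables of the same names); credit for every lemma is the leads'.
Refs: JaffeWitten2000 §4–§6; OsterwalderSeiler1978 §§2–4; Balaban1989LargeFieldII; Luscher1977; GlimmJaffe1987 §6.1, §19.
-/

noncomputable section

namespace Summit.QuantumFields.YangMills.Theorems.ContinuumLegGivenGapSplit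

open scoped SchwartzMap
open Filter Topology MeasureTheory
open Literature.MathematicalPhysics.QuantumFieldTheory Literature.MathematicalPhysics.QuantumLattice
  Literature.MathematicalPhysics.AQFT Literature.Probability.LatticeModels
open Literature.Barriers.QuantumFields (subScheme subScheme_a subScheme_β subScheme_L subScheme_side
  hasLatticeMassGap_subScheme hasWeakCouplingLimit_subScheme)
open Summit.QuantumFields.YangMills.Theorems.ContinuumLegGivenGap (hasLatticeMassGap_of_uniformClustering
  lsk_eq_curvDistribution uuvb_of_unfolded stub_witness stub_critical stub_uvb stub_windowOfNG stub_extract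
  stub_lockOfRpCore stub_rpCore stub_rotNiven stub_rotHyper stub_rotOfPythagorean stub_asympCS stub_smallRotation
  stub_bddSlabDensity stub_uclOfCscl stub_cltOfCscl)
open Summit.QuantumFields.YangMills.Theorems.OSLegsFromFemtoAndGap (exists_subseq_clm_limit)

open Summit.QuantumFields.YangMills.Theses
open Summit.QuantumFields.YangMills.Cruxes.ContinuumLimitOnTrajectory.TwoOrbitSynchronisation
  (curvDistribution curvNPoint canon curvCLM curvCLM_apply curvDistribution_tensor curvDistribution_sub
   ConvProducts AsympEuclid ND2 ND3 UCL oneFieldOSLegs' torusSlabRP_of_tendsto)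

/-! ## §0 Vocabulary (bodies over existing declarations only; stubs are stated WITHOUT these abbreviations) -/

variable {G : Type} [Group G] [TopologicalSpace G] [IsTopologicalGroup G] [CompactSpace G]
  [MeasurableSpace G] [BorelSpace G]

/-- The crux's hypothesis at one `(G, r)`: above `β₀`, at each `β` some rate `m > 0`, some volume
threshold `S₁` and per-pair constants. [folklore] -/
def GapHypAt (r : LatticeRep G) : Prop :=
  ∃ β₀ : ℝ, ∀ β : ℝ, β₀ ≤ β → ∃ m : ℝ, 0 < m ∧ ∃ S₁ : ℕ, ∀ A B : YMSpecies G, ∃ C : ℝ,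
    ∀ S n : ℕ, S₁ ≤ S → n ≤ S →
      |latticeConnectedCorr r.ρ β (2 * S + 1) A.F B.F n| ≤ C * Real.exp (-(m * n))

/-- **Locked IR data along a sequence** (output of the landed `stub_lock_of_twoSidedCore`): couplings `β_k → ∞`,
rates `m̂_k > 0`, thresholds `S₁ k`, a sharpness factor `K > 0`, (UNIFORM) one constant per pair for all `k` on the
tori `S ≥ S₁ k`, `n ≤ S`, and (SHARP) no volume-uniform clustering at rate `K m̂_k` at `β_k`. [folklore] -/
def LockedAlong (r : LatticeRep G) (β : ℕ → ℝ) (mh : ℕ → ℝ) (S₁ : ℕ → ℕ) (K : ℝ) : Prop :=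
  Tendsto β atTop atTop ∧ (∀ k, 0 < mh k) ∧ 0 < K ∧
    (∀ A B : YMSpecies G, ∃ C : ℝ, ∀ k S n : ℕ, S₁ k ≤ S → n ≤ S →
      |latticeConnectedCorr r.ρ (β k) (2 * S + 1) A.F B.F n| ≤ C * Real.exp (-(mh k * n))) ∧
    (∀ k S₀ : ℕ, ∃ A B : YMSpecies G, ∀ C : ℝ, ∃ S n : ℕ, S₀ ≤ S ∧ n ≤ S ∧
      C * Real.exp (-(K * mh k * n)) < |latticeConnectedCorr r.ρ (β k) (2 * S + 1) A.F B.F n|)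

/-- The smeared torus `n`-point functional of the renormalised curvature species at step `k`:
`∫ Σ_{x ∈ boxⁿ} F(a_k x) ∏ᵢ c_k a_k⁴ (P(τ_{xᵢ} Ũ) − m_k) dμ_{β_k, 2L_k+1}`. [folklore] -/
def LSk (r : LatticeRep G) (sch : SpeciesScheme (YMSpecies G)) (k n : ℕ)
    (F : 𝓢((Fin n → EuclideanSpace ℝ (Fin 4)), ℂ)) : ℂ :=
  ∫ U, ∑ x : Fin n → ↥(box 4 (sch.L k)), F (fun i => sch.a k • siteToE ↑(x i)) *
      ∏ i, ((sch.c r.curvature k * sch.a k ^ 4 *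
        (r.curvature.F (configShift (-↑(x i)) (torusLift (sch.side k) U)) - sch.m r.curvature k) : ℝ) : ℂ)
    ∂(wilsonMeasure (d := 4) (L := sch.side k) r.ρ (sch.β k))

/-- (VS) exact centring: `m_k` is the torus mean of the action density. [folklore] -/
def VS (r : LatticeRep G) (sch : SpeciesScheme (YMSpecies G)) : Prop :=
  ∀ k : ℕ, sch.m r.curvature k =
    ∫ U, r.curvature.F (torusLift (sch.side k) U) ∂(wilsonMeasure (d := 4) (L := sch.side k) r.ρ (sch.β k))

/-- (CAN) canonical normalisation of the curvature species: `c_k = a_k⁻⁴`. [folklore] -/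
def CAN (r : LatticeRep G) (sch : SpeciesScheme (YMSpecies G)) : Prop :=
  ∀ k : ℕ, sch.c r.curvature k = (sch.a k ^ 4)⁻¹

/-- (UUVB) uniform-threshold E0′-type bounds for all corner-PLAQUETTE strings (route ParabolicTrajectory's `UUVB`
unfolded into `plaquetteObs`/`wilsonTorusMean`). [folklore] -/
def UUVB (r : LatticeRep G) (sch : SpeciesScheme (YMSpecies G)) : Prop :=
  ∃ (s : ℕ) (α β' : ℝ), ∀ᶠ k in atTop, ∀ (p : ℕ) (q : Fin p → {q : Fin 4 × Fin 4 // q.1 < q.2})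
    (F : 𝓢((Fin p → EuclideanSpace ℝ (Fin 4)), ℂ)), IsOffDiagonal F →
    ‖∫ U : GaugeConfig 4 (sch.side k) G, ∑ x : Fin p → ↥(box 4 (sch.L k)),
        F (fun i => sch.a k • siteToE ↑(x i)) *
          ∏ i, ((plaquetteObs r.ρ 0 (q i).1.1 (q i).1.2 (configShift (-↑(x i)) (torusLift (sch.side k) U)) -
            wilsonTorusMean r.ρ (sch.β k) (sch.L k) (plaquetteObs r.ρ 0 (q i).1.1 (q i).1.2) : ℝ) : ℂ)
        ∂(wilsonMeasure (d := 4) (L := sch.side k) r.ρ (sch.β k))‖ ≤ α * (p.factorial : ℝ) ^ β' * schwartzNorm (p * s) F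

/-- (ND) the two-point floor (the `IsNontrivial` witness on the lattice). [folklore] -/
def ND (r : LatticeRep G) (sch : SpeciesScheme (YMSpecies G)) : Prop :=
  ∃ (f g : 𝓢((Fin 1 → EuclideanSpace ℝ (Fin 4)), ℂ)) (H : 𝓢((Fin (1 + 1) → EuclideanSpace ℝ (Fin 4)), ℂ)),
    IsTimeOrdered f ∧ IsTimeOrdered g ∧ IsAppendTensorOf H (osAdjoint f) g ∧
      ∃ δ : ℝ, 0 < δ ∧ ∀ᶠ k in atTop, δ ≤ ‖LSk r sch k (1 + 1) H‖

/-- (CL-t) time-axis exponential clustering of the smeared functionals, per-pair constants. [folklore] -/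
def CLt (r : LatticeRep G) (sch : SpeciesScheme (YMSpecies G)) : Prop :=
  ∃ Δ : ℝ, 0 < Δ ∧ ∀ (n m : ℕ) (F : 𝓢((Fin n → EuclideanSpace ℝ (Fin 4)), ℂ))
    (G' : 𝓢((Fin m → EuclideanSpace ℝ (Fin 4)), ℂ)), IsTimeOrdered F → IsTimeOrdered G' →
    ∃ C : ℝ, ∀ t : ℝ, 0 ≤ t → ∀ᶠ k in atTop,
      ∀ H : 𝓢((Fin (n + m) → EuclideanSpace ℝ (Fin 4)), ℂ),
        IsAppendTensorOf H (osAdjoint F) (translateMulti (EuclideanSpace.single 0 t) G') →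
          ‖LSk r sch k (n + m) H - LSk r sch k n (osAdjoint F) * LSk r sch k m G'‖ ≤ C * Real.exp (-Δ * t)

-- (UCL) k-uniform rate-free spatial clustering (E4 input): since reshape 15 this is route ParabolicTrajectory's
-- `UCL r sch` (on `curvDistribution`, which IS `LSk` under (CAN) ∧ (VS)), DERIVED by `stub_uclOfCscl`.

/-- (PVG) polynomial volume growth of the scheme (route ParabolicTrajectory's `PolyVolumeGrowth` unfolded): the physical
torus half-side dominates a power of the inverse spacing, eventually. [folklore] -/
def PVG (sch : SpeciesScheme (YMSpecies G)) : Prop :=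
  ∃ N : ℕ, 1 ≤ N ∧ ∀ᶠ k in atTop, (sch.a k)⁻¹ ≤ (sch.a k * (sch.L k : ℝ)) ^ N

/-- (EUC) asymptotic translation invariance on `⁰𝒮` (translation half of E1; DERIVED in reshape 13 from (PVG) ∧ (UUVB) by
route ParabolicTrajectory's landed `stub_transl`). [folklore] -/
def EUC (r : LatticeRep G) (sch : SpeciesScheme (YMSpecies G)) : Prop :=
  ∀ (n : ℕ) (F : 𝓢((Fin n → EuclideanSpace ℝ (Fin 4)), ℂ)), IsOffDiagonal F → ∀ a : EuclideanSpace ℝ (Fin 4),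
    Tendsto (fun k : ℕ => LSk r sch k n (translateMulti a F) - LSk r sch k n F) atTop (𝓝 0)

/-- (ROT) asymptotic restoration of proper rotations on `⁰𝒮` (rotation half of E1). [folklore] -/
def ROT (r : LatticeRep G) (sch : SpeciesScheme (YMSpecies G)) : Prop :=
  ∀ (n : ℕ) (F : 𝓢((Fin n → EuclideanSpace ℝ (Fin 4)), ℂ)), IsOffDiagonal F →
    ∀ R : EuclideanSpace ℝ (Fin 4) ≃ₗᵢ[ℝ] EuclideanSpace ℝ (Fin 4),
      LinearMap.det (R.toLinearEquiv : EuclideanSpace ℝ (Fin 4) →ₗ[ℝ] EuclideanSpace ℝ (Fin 4)) = 1 →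
        Tendsto (fun k : ℕ => LSk r sch k n (linActMulti R F) - LSk r sch k n F) atTop (𝓝 0)

/-- (CSCL) Cauchy–Schwarz clustering of the canonical scheme's lattice Schwinger functions at some rate `Δ₁ > 0`
(Literature `SpeciesScheme.HasCSClustering`); since reshape 17 DERIVED from the lock by `stub_csclOfLock`. [folklore] -/
def CSCL (r : LatticeRep G) (sch : SpeciesScheme (YMSpecies G)) : Prop :=
  ∃ Δ₁ : ℝ, 0 < Δ₁ ∧ SpeciesScheme.HasCSClustering r (canon r sch) Δ₁

/-- (UVB) the E0′-type bound for `LSk` with `F`-dependent threshold (derived: landed `stub_uvb`). [folklore] -/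
def UVB (r : LatticeRep G) (sch : SpeciesScheme (YMSpecies G)) : Prop :=
  ∃ (s : ℕ) (α β : ℝ), ∀ (n : ℕ) (F : 𝓢((Fin n → EuclideanSpace ℝ (Fin 4)), ℂ)), IsOffDiagonal F →
    ∀ᶠ k in atTop, ‖LSk r sch k n F‖ ≤ α * (n.factorial : ℝ) ^ β * schwartzNorm (n * s) F

/-- (NG) the skewness floor, FREQUENTLY in `k`. [folklore] -/
def NG (r : LatticeRep G) (sch : SpeciesScheme (YMSpecies G)) : Prop :=
  ∃ (f g h : 𝓢(EuclideanSpace ℝ (Fin 4), ℂ)) (F₃ : 𝓢((Fin 3 → EuclideanSpace ℝ (Fin 4)), ℂ)),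
    IsTensorOf F₃ ![f, g, h] ∧ IsOffDiagonal F₃ ∧ ∃ δ : ℝ, 0 < δ ∧ ∃ᶠ k in atTop, δ ≤ ‖LSk r sch k 3 F₃‖

/-- **The NLO skewness window** (card K1 ∧ K2), subsequential. [folklore] -/
def SkewWindow (r : LatticeRep G) (sch : SpeciesScheme (YMSpecies G)) : Prop :=
  ∃ (s₃ : ℂ) (φ : ℕ → ℕ) (f g h : ℕ → 𝓢(EuclideanSpace ℝ (Fin 4), ℂ))
    (F₃ : ℕ → 𝓢((Fin 3 → EuclideanSpace ℝ (Fin 4)), ℂ)) (w : ℕ → ℝ),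
    s₃ ≠ 0 ∧ StrictMono φ ∧ (∀ j, 0 < w j) ∧ (∀ j, IsTensorOf (F₃ j) ![f j, g j, h j] ∧ IsOffDiagonal (F₃ j)) ∧
      ∀ ε : ℝ, 0 < ε → ∀ᶠ j in atTop, ∀ᶠ k in atTop, ‖LSk r sch (φ k) 3 (F₃ j) / (w j : ℂ) - s₃‖ ≤ ε

/-! ## §1 Read-backs (definitional) -/

/-- The four route declarations of the shared item are one proposition. [folklore] -/
theorem smallCircleAnchor_iff :
    SmallCircleAnchor.ContinuumLegGivenGap ↔ ConvexGribovBody.ContinuumLegGivenGap := Iff.rfl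

/-- (ditto, route `HyperbolicRegulator`). [folklore] -/
theorem hyperbolicRegulator_iff :
    HyperbolicRegulator.ContinuumLegGivenGap ↔ ConvexGribovBody.ContinuumLegGivenGap := Iff.rfl

/-- (ditto, route `ContractibleFibre`, decl `WeakCouplingContinuumLeg`). [folklore] -/
theorem contractibleFibre_iff :
    ContractibleFibre.WeakCouplingContinuumLeg ↔ ConvexGribovBody.ContinuumLegGivenGap := Iff.rfl

/-! ## §2 The three open pieces of line `Sketch` (reshape 18) as HYPOTHESES

section variables named after the stubs they stand for: `stub_uvPackageVol` (the UV engine, volume-uniform),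
`stub_csclOfLock` (provable 17-CS glue), `stub_skewWindow` (the NLO skewness window) — statements verbatim the registered stubs of stmt-QuantumFields-15828. -/

variable
  (stub_uvPackageVol : ∀ (G : Type) [Group G] [TopologicalSpace G] [IsTopologicalGroup G] [CompactSpace G] [MeasurableSpace G] [BorelSpace G], IsCompactSimpleLieGroup G → ∃ r : LatticeRep G, ∀ (β : ℕ → ℝ) (mh : ℕ → ℝ) (S₁ : ℕ → ℕ) (K : ℝ), Tendsto β atTop atTop → (∀ k, 0 < mh k) → 0 < K → (∀ A B : YMSpecies G, ∃ C : ℝ, ∀ k S n : ℕ, S₁ k ≤ S → n ≤ S → |latticeConnectedCorr r.ρ (β k) (2 * S + 1) A.F B.F n| ≤ C * Real.exp (-(mh k * n))) → (∀ k S₀ : ℕ, ∃ A B : YMSpecies G, ∀ C : ℝ, ∃ S n : ℕ, S₀ ≤ S ∧ n ≤ S ∧ C * Real.exp (-(K * mh k * n)) < |latticeConnectedCorr r.ρ (β k) (2 * S + 1) A.F B.F n|) → Tendsto mh atTop (𝓝 0) → ∃ (a : ℕ → ℝ) (φ : ℕ → ℕ) (Δ₀ : ℝ) (𝓛 : ℕ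 → Set ℕ), (∀ k, 0 < a k) ∧ StrictMono φ ∧ 0 < Δ₀ ∧ (∀ k, Δ₀ * a k ≤ mh (φ k)) ∧ (∀ k S : ℕ, ∃ S' : ℕ, S' ∈ 𝓛 k ∧ S ≤ S') ∧ (∀ k : ℕ, ∀ S ∈ 𝓛 k, S₁ (φ k) ≤ S) ∧ (∃ N : ℕ, 1 ≤ N ∧ ∀ᶠ k in atTop, ∀ S ∈ 𝓛 k, (a k)⁻¹ ≤ (a k * (S : ℝ)) ^ N) ∧ ∀ (sch : SpeciesScheme (YMSpecies G)), (∀ k, sch.a k = a k) → (∀ k, sch.β k = β (φ k)) → (∀ k, sch.L k ∈ 𝓛 k) → ∀ (LS : (k n : ℕ) → SchwartzMap (Fin n → EuclideanSpace ℝ (Fin 4)) ℂ → ℂ), (∀ (k n : ℕ) (F : SchwartzMap (Fin n → EuclideanSpace ℝ (Fin 4)) ℂ), LS k n F = ∫ U : GaugeConfig 4 (sch.side k) G, ∑ x : Fin n → ↥(Literature.Probability.LatticeModels.box 4 (sch.L k)), F (fun i => sch.a k • siteToE ↑(x i)) * ∏ i, ((sch.c r.curvature k * sch.a k ^ 4 *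 (r.curvature.F (Literature.MathematicalPhysics.QuantumLattice.configShift (-↑(x i)) (Literature.MathematicalPhysics.QuantumLattice.torusLift (sch.side k) U)) - sch.m r.curvature k) : ℝ) : ℂ) ∂(wilsonMeasure r.ρ (sch.β k))) → (∀ k : ℕ, sch.m r.curvature k = ∫ U : GaugeConfig 4 (sch.side k) G, r.curvature.F (Literature.MathematicalPhysics.QuantumLattice.torusLift (sch.side k) U) ∂(wilsonMeasure r.ρ (sch.β k))) → (∀ k : ℕ, sch.c r.curvature k = (sch.a k ^ 4)⁻¹) → (∃ (s : ℕ) (α β' : ℝ), ∀ᶠ k in atTop, ∀ (p : ℕ) (q : Fin p → {q : Fin 4 × Fin 4 // q.1 < q.2}) (F : SchwartzMap (Fin p → EuclideanSpace ℝ (Fin 4)) ℂ), IsOffDiagonal F → ‖∫ U : GaugeConfig 4 (sch.side k) G, ∑ x : Fin p → ↥(Literature.Probability.LatticeModels.box 4 (sch.L k)), F (fun i => sch.a k • siteToE ↑(x i)) * ∏ i, ((plaquetteObs r.ρ 0 (q i).1.1 (q i).1.2 (Literature.MathematicalPhysics.QuantumLattice.configShift (-↑(x i)) (Literature.MathematicalPhysics.QuantumLattice.torusLift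 (sch.side k) U)) - wilsonTorusMean r.ρ (sch.β k) (sch.L k) (plaquetteObs r.ρ 0 (q i).1.1 (q i).1.2) : ℝ) : ℂ) ∂(wilsonMeasure r.ρ (sch.β k))‖ ≤ α * (p.factorial : ℝ) ^ β' * schwartzNorm (p * s) F) ∧ (∃ (f g : SchwartzMap (Fin 1 → EuclideanSpace ℝ (Fin 4)) ℂ) (H : SchwartzMap (Fin (1 + 1) → EuclideanSpace ℝ (Fin 4)) ℂ), IsTimeOrdered f ∧ IsTimeOrdered g ∧ IsAppendTensorOf H (osAdjoint f) g ∧ ∃ δ : ℝ, 0 < δ ∧ ∀ᶠ k in atTop, δ ≤ ‖LS k (1 + 1) H‖) ∧ (∀ R : EuclideanSpace ℝ (Fin 4) ≃ₗᵢ[ℝ] EuclideanSpace ℝ (Fin 4), R (EuclideanSpace.single 0 1) = (3 / 5 : ℝ) • EuclideanSpace.single 0 1 + (-(4 / 5) : ℝ) • EuclideanSpace.single 1 1 → R (EuclideanSpace.single 1 1) = (4 / 5 : ℝ) • EuclideanSpace.single 0 1 + (3 / 5 : ℝ) • EuclideanSpace.single 1 1 → R (EuclideanSpace.single 2 1) =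 EuclideanSpace.single 2 1 → R (EuclideanSpace.single 3 1) = EuclideanSpace.single 3 1 → ∀ (n : ℕ) (F : SchwartzMap (Fin n → EuclideanSpace ℝ (Fin 4)) ℂ), IsOffDiagonal F → Tendsto (fun k : ℕ => LS k n (linActMulti R F) - LS k n F) atTop (𝓝 0)))
  (stub_csclOfLock : ∀ (G : Type) [Group G] [TopologicalSpace G] [IsTopologicalGroup G] [CompactSpace G] [MeasurableSpace G] [BorelSpace G] (r : LatticeRep G) (β mh : ℕ → ℝ) (S₁ : ℕ → ℕ) (a : ℕ → ℝ) (φ : ℕ → ℕ) (Δ₀ : ℝ) (𝓛 : ℕ → Set ℕ), Tendsto β atTop atTop → (∀ k, 0 < mh k) → (∀ A B : YMSpecies G, ∃ C : ℝ, ∀ k S n : ℕ, S₁ k ≤ S → n ≤ S → |latticeConnectedCorr r.ρ (β k) (2 * S + 1) A.F B.F n| ≤ C * Real.exp (-(mh k * n))) → (∀ k, 0 < a k) → StrictMono φ → 0 < Δ₀ → (∀ k, Δ₀ * a k ≤ mh (φ k)) → Tendsto mh atTop (𝓝 0) → (∀ k S : ℕ, ∃ S' : ℕ, S' ∈ 𝓛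 k ∧ S ≤ S') → (∀ k : ℕ, ∀ S ∈ 𝓛 k, S₁ (φ k) ≤ S) → (∃ N : ℕ, 1 ≤ N ∧ ∀ᶠ k in atTop, ∀ S ∈ 𝓛 k, (a k)⁻¹ ≤ (a k * (S : ℝ)) ^ N) → (∀ (sch : SpeciesScheme (YMSpecies G)), (∀ k, sch.a k = a k) → (∀ k, sch.β k = β (φ k)) → (∀ k, sch.L k ∈ 𝓛 k) → (∀ k : ℕ, sch.m r.curvature k = ∫ U : GaugeConfig 4 (sch.side k) G, r.curvature.F (torusLift (sch.side k) U) ∂(wilsonMeasure r.ρ (sch.β k))) → (∀ k : ℕ, sch.c r.curvature k = (sch.a k ^ 4)⁻¹) → (∃ (s : ℕ) (α β' : ℝ), ∀ᶠ k in atTop, ∀ (p : ℕ) (q : Fin p → {q : Fin 4 × Fin 4 // q.1 < q.2}) (F : SchwartzMap (Fin p → EuclideanSpace ℝ (Fin 4)) ℂ), IsOffDiagonal F → ‖∫ U : GaugeConfig 4 (sch.side k) G, ∑ x : Fin p → ↥(box 4 (sch.L k)), F (fun i => sch.a k • siteToE ↑(x i)) * ∏ i, ((plaquetteObs r.ρ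 0 (q i).1.1 (q i).1.2 (configShift (-↑(x i)) (torusLift (sch.side k) U)) - wilsonTorusMean r.ρ (sch.β k) (sch.L k) (plaquetteObs r.ρ 0 (q i).1.1 (q i).1.2) : ℝ) : ℂ) ∂(wilsonMeasure r.ρ (sch.β k))‖ ≤ α * (p.factorial : ℝ) ^ β' * schwartzNorm (p * s) F)) → ∃ sch : SpeciesScheme (YMSpecies G), (∀ k, sch.a k = a k) ∧ (∀ k, sch.β k = β (φ k)) ∧ (∀ k, sch.L k ∈ 𝓛 k) ∧ (∀ k : ℕ, sch.c r.curvature k = (sch.a k ^ 4)⁻¹) ∧ (∀ k : ℕ, sch.m r.curvature k = ∫ U : GaugeConfig 4 (sch.side k) G, r.curvature.F (torusLift (sch.side k) U) ∂(wilsonMeasure r.ρ (sch.β k))) ∧ ∃ Δ₁ : ℝ, 0 < Δ₁ ∧ SpeciesScheme.HasCSClustering r (canon r sch) Δ₁)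
  (stub_skewWindow : ∀ (G : Type) [Group G] [TopologicalSpace G] [IsTopologicalGroup G] [CompactSpace G] [MeasurableSpace G] [BorelSpace G], IsCompactSimpleLieGroup G → ∀ (r : LatticeRep G) (sch : SpeciesScheme (YMSpecies G)) (LS : (k n : ℕ) → SchwartzMap (Fin n → EuclideanSpace ℝ (Fin 4)) ℂ → ℂ), (∀ (k n : ℕ) (F : SchwartzMap (Fin n → EuclideanSpace ℝ (Fin 4)) ℂ), LS k n F = ∫ U : GaugeConfig 4 (sch.side k) G, ∑ x : Fin n → ↥(box 4 (sch.L k)), F (fun i => sch.a k • siteToE ↑(x i)) * ∏ i, ((sch.c r.curvature k * sch.a k ^ 4 * (r.curvature.F (configShift (-↑(x i)) (torusLift (sch.side k) U)) - sch.m r.curvature k) : ℝ) : ℂ) ∂(wilsonMeasure r.ρ (sch.β k))) → Tendsto sch.β atTop atTop → (∀ k : ℕ, sch.m r.curvature k = ∫ U : GaugeConfig 4 (sch.side k) G, r.curvature.F (torusLift (sch.side k) U) ∂(wilsonMeasure r.ρ (sch.β k))) → (∃ (s : ℕ) (α β' : ℝ), ∀ (n : ℕ) (F : SchwartzMap (Fin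 n → EuclideanSpace ℝ (Fin 4)) ℂ), IsOffDiagonal F → ∀ᶠ k in atTop, ‖LS k n F‖ ≤ α * (n.factorial : ℝ) ^ β' * schwartzNorm (n * s) F) → (∃ (f g : SchwartzMap (Fin 1 → EuclideanSpace ℝ (Fin 4)) ℂ) (H : SchwartzMap (Fin (1 + 1) → EuclideanSpace ℝ (Fin 4)) ℂ), IsTimeOrdered f ∧ IsTimeOrdered g ∧ IsAppendTensorOf H (osAdjoint f) g ∧ ∃ δ : ℝ, 0 < δ ∧ ∀ᶠ k in atTop, δ ≤ ‖LS k (1 + 1) H‖) → (∃ Δ : ℝ, 0 < Δ ∧ ∀ (n m : ℕ) (F : SchwartzMap (Fin n → EuclideanSpace ℝ (Fin 4)) ℂ) (G' : SchwartzMap (Fin m → EuclideanSpace ℝ (Fin 4)) ℂ), IsTimeOrdered F → IsTimeOrdered G' → ∃ C : ℝ, ∀ t : ℝ, 0 ≤ t → ∀ᶠ k in atTop, ∀ H : SchwartzMap (Fin (n + m) → EuclideanSpace ℝ (Fin 4)) ℂ, IsAppendTensorOf H (osAdjoint F) (translateMulti (EuclideanSpace.single 0 t) G') → ‖LS k (n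 + m) H - LS k n (osAdjoint F) * LS k m G'‖ ≤ C * Real.exp (-Δ * t)) → ∃ (s₃ : ℂ) (φ : ℕ → ℕ) (f g h : ℕ → SchwartzMap (EuclideanSpace ℝ (Fin 4)) ℂ) (F₃ : ℕ → SchwartzMap (Fin 3 → EuclideanSpace ℝ (Fin 4)) ℂ) (w : ℕ → ℝ), s₃ ≠ 0 ∧ StrictMono φ ∧ (∀ j, 0 < w j) ∧ (∀ j, IsTensorOf (F₃ j) ![f j, g j, h j] ∧ IsOffDiagonal (F₃ j)) ∧ ∀ ε : ℝ, 0 < ε → ∀ᶠ j in atTop, ∀ᶠ k in atTop, ‖LS (φ k) 3 (F₃ j) / (w j : ℂ) - s₃‖ ≤ ε)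

/-! ## §3 Composition (sorries only in the open `stub_*`; landed stubs by name; every glue lemma below is PROVED) -/

/-! ### §3.1 The UV package at the chosen representation -/

include stub_uvPackageVol stub_csclOfLock in
/-- Abbreviation-level repackaging of `stub_uvPackage`'s output at the representation it chooses. [folklore] -/
theorem uvPackage_exists (hG : IsCompactSimpleLieGroup G) :
    ∃ r : LatticeRep G, ∀ {β : ℕ → ℝ} {mh : ℕ → ℝ} {S₁ : ℕ → ℕ} {K : ℝ},
      LockedAlong r β mh S₁ K → Tendsto mh atTop (𝓝 0) →
        ∃ (sch : SpeciesScheme (YMSpecies G)) (φ : ℕ → ℕ) (Δ₀ : ℝ), StrictMono φ ∧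
          (∀ k, sch.β k = β (φ k)) ∧ 0 < Δ₀ ∧ (∀ k, Δ₀ * sch.a k ≤ mh (φ k)) ∧ (∀ k, S₁ (φ k) ≤ sch.L k) ∧
            VS r sch ∧ CAN r sch ∧ UUVB r sch ∧ ND r sch ∧ CLt r sch ∧ UCL r sch ∧ PVG sch ∧ ROT r sch ∧
              CSCL r sch := by
  obtain ⟨r, hr⟩ := stub_uvPackageVol G hG
  refine ⟨r, @fun β mh S₁ K hL hcrit => ?_⟩
  obtain ⟨a, φ, Δ₀, 𝓛, ha0, hφ, hΔ₀, ha, hcof, hthr, hpvg, hper⟩ :=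
    hr _ _ _ _ hL.1 hL.2.1 hL.2.2.1 hL.2.2.2.1 hL.2.2.2.2 hcrit
  -- reshape 17: the scheme (its torus chosen in `𝓛`) and (CSCL) come from the glue `stub_csclOfLock`
  obtain ⟨sch, hsa, hβ, hsL, hCAN, hVS, hCS⟩ :=
    stub_csclOfLock G r β mh S₁ a φ Δ₀ 𝓛 hL.1 hL.2.1 hL.2.2.2.1 ha0 hφ hΔ₀ ha hcrit hcof hthr hpvg
      (fun sch' h1 h2 h3 hVS' hCAN' => (hper sch' h1 h2 h3 (LSk r sch') (fun _ _ _ => rfl) hVS' hCAN').1)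
  obtain ⟨hUUVB, hND, hROT345⟩ := hper sch hsa hβ hsL (LSk r sch) (fun _ _ _ => rfl) hVS hCAN
  have ha' : ∀ k, Δ₀ * sch.a k ≤ mh (φ k) := fun k => by rw [hsa k]; exact ha k
  have hLk : ∀ k, S₁ (φ k) ≤ sch.L k := fun k => hthr k _ (hsL k)
  have hPVG : PVG sch := by
    obtain ⟨N, hN, hev⟩ := hpvg
    refine ⟨N, hN, hev.mono fun k hk => ?_⟩
    have h := hk (sch.L k) (hsL k)
    rwa [← hsa k] at h
  have hlsk := lsk_eq_curvDistribution r sch (LSk r sch) (fun _ _ _ => rfl) hCAN hVS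
  -- reshape 16: (ROT) is derived from (ROT₃₄₅) ∧ (UUVB) by `stub_rotOfPythagorean` ∘ (`stub_rotNiven`, `stub_rotHyper`)
  have hROT : ROT r sch := by
    intro n F hF R hR
    have h := stub_rotOfPythagorean G r sch stub_rotNiven stub_rotHyper (uuvb_of_unfolded r sch hUUVB)
      (fun R' h0 h1 h2 h3 p F' hF' => by simpa only [hlsk] using hROT345 R' h0 h1 h2 h3 p F' hF') n F hF R hR
    simpa only [hlsk] using h
  -- reshape 14: (CL-t) is derived from (CAN) ∧ (VS) ∧ (UUVB) ∧ (PVG) ∧ (CSCL) by the glue stub `stub_cltOfCscl`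
  have hCLt : CLt r sch := stub_cltOfCscl G r sch (LSk r sch) (fun _ _ _ => rfl) hCAN hVS hUUVB hPVG hCS
  -- reshape 15: (UCL) is derived from (CSCL) ∧ (ROT) ∧ (UUVB) ∧ (PVG) ∧ (AF) by `stub_uclOfCscl`
  have hAF : Tendsto sch.β atTop atTop := by
    rw [show sch.β = fun k => β (φ k) from funext hβ]
    exact hL.1.comp hφ.tendsto_atTop
  have hROT' : ∀ (p : ℕ) (F : 𝓢((Fin p → EuclideanSpace ℝ (Fin 4)), ℂ)), IsOffDiagonal F →
      ∀ R : EuclideanSpace ℝ (Fin 4) ≃ₗᵢ[ℝ] EuclideanSpace ℝ (Fin 4),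
        LinearMap.det (R.toLinearEquiv : EuclideanSpace ℝ (Fin 4) →ₗ[ℝ] EuclideanSpace ℝ (Fin 4)) = 1 →
          Tendsto (fun k : ℕ => curvDistribution r sch k p (linActMulti R F) - curvDistribution r sch k p F)
            atTop (𝓝 0) := by
    intro p F hF R hR
    simpa only [hlsk] using hROT p F hF R hR
  have hUCL : UCL r sch :=
    stub_uclOfCscl G r sch stub_asympCS stub_smallRotation stub_bddSlabDensity hAF (uuvb_of_unfolded r sch hUUVB)
      hPVG hROT' hCS
  exact ⟨sch, φ, Δ₀, hφ, hβ, hΔ₀, ha', hLk, hVS, hCAN, hUUVB, hND, hCLt, hUCL, hPVG, hROT, hCS⟩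

/-! ### §3.2 The IR lock, criticality, the lattice gap -/

/-- **The lock from the RP core** (reshape 17): `stub_lockOfRpCore` applied to `stub_rpCore` (itself assembled, in
its own Theorems file, from the three registered glue stubs `stub_rpFormsCS` / `stub_rpShift` / `stub_obsGeometry`
above and the chord bound), under `XiDiverges` and the crux's hypothesis at `r`. [folklore] -/
theorem locked_of_core (hXi : DirichletWindow.XiDiverges) (hG : IsCompactSimpleLieGroup G) (r : LatticeRep G)
    (hGap : GapHypAt r) : ∃ (β : ℕ → ℝ) (mh : ℕ → ℝ) (S₁ : ℕ → ℕ) (K : ℝ), LockedAlong r β mh S₁ K := by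
  obtain ⟨β, mh, S₁, K, h1, h2, h3, h4, h5⟩ := stub_lockOfRpCore hXi G hG r hGap (stub_rpCore G r)
  exact ⟨β, mh, S₁, K, h1, h2, h3, h4, h5⟩

/-- (GAP) for the UV-built scheme is bookkeeping: the UNIFORM constants transported along `φ`, the thresholds below
`L_k`, the unit `Δ₀ a_k ≤ m̂_{φ k}` (landed `hasLatticeMassGap_of_uniformClustering`). [folklore] -/
theorem gap_of_locked (r : LatticeRep G) {β : ℕ → ℝ} {mh : ℕ → ℝ} {S₁ : ℕ → ℕ} {K : ℝ}
    (hL : LockedAlong r β mh S₁ K) {sch : SpeciesScheme (YMSpecies G)} {φ : ℕ → ℕ} {Δ₀ : ℝ}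
    (hβ : ∀ k, sch.β k = β (φ k)) (ha : ∀ k, Δ₀ * sch.a k ≤ mh (φ k))
    (hLk : ∀ k, S₁ (φ k) ≤ sch.L k) : HasLatticeMassGap r sch Δ₀ := by
  refine hasLatticeMassGap_of_uniformClustering r sch Δ₀ (fun k => mh (φ k)) (Eventually.of_forall ha) fun A B => ?_
  obtain ⟨C, hC⟩ := hL.2.2.2.1 A B
  refine ⟨C, Eventually.of_forall fun k S hS n hn => ?_⟩
  rw [hβ k]
  exact hC (φ k) S n ((hLk k).trans hS) hn

/-- The lattice gap is monotone in the rate. [folklore] -/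
theorem hasLatticeMassGap_mono (r : LatticeRep G) (sch : SpeciesScheme (YMSpecies G)) {Δ Δ' : ℝ}
    (hΔ : Δ' ≤ Δ) (h : HasLatticeMassGap r sch Δ) : HasLatticeMassGap r sch Δ' := by
  intro A B
  obtain ⟨C, hC⟩ := h A B
  refine ⟨max C 0, hC.mono fun k hk S hS n hn => (hk S hS n hn).trans ?_⟩
  have h1 : Real.exp (-(Δ * (sch.a k * n))) ≤ Real.exp (-(Δ' * (sch.a k * n))) :=
    Real.exp_le_exp.2 (neg_le_neg (mul_le_mul_of_nonneg_right hΔ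
      (mul_nonneg (sch.a_pos k).le (Nat.cast_nonneg n))))
  calc C * Real.exp (-(Δ * (sch.a k * n))) ≤ max C 0 * Real.exp (-(Δ * (sch.a k * n))) :=
        mul_le_mul_of_nonneg_right (le_max_left _ _) (Real.exp_pos _).le
    _ ≤ max C 0 * Real.exp (-(Δ' * (sch.a k * n))) := mul_le_mul_of_nonneg_left h1 (le_max_right _ _)

/-! ### §3.3 The card: the skewness floor, frequently -/

/-- **The card's first lemma, subsequential form** (from the LANDED `stub_witness`, p121579). [folklore] -/
theorem ng_of_skewWindow (r : LatticeRep G) (sch : SpeciesScheme (YMSpecies G)) (h : SkewWindow r sch) :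
    NG r sch := by
  obtain ⟨s₃, φ, f, g, h, F₃, w, hs₃, hφ, hw, hF, hwin⟩ := h
  obtain ⟨f₀, g₀, h₀, F₀, hT, hO, δ, hδ, hfreq⟩ :=
    Summit.QuantumFields.YangMills.Theorems.ContinuumLegGivenGap.stub_witness
      (fun k F => LSk r sch (φ k) 3 F) ⟨s₃, f, g, h, F₃, w, hs₃, hw, hF, hwin⟩
  exact ⟨f₀, g₀, h₀, F₀, hT, hO, δ, hδ, hφ.tendsto_atTop.frequently hfreq⟩

/-- (UVB) from (CAN) ∧ (VS) ∧ (UUVB) (landed `stub_uvb`, p125690). [folklore] -/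
theorem uvb_of_uuvb (r : LatticeRep G) (sch : SpeciesScheme (YMSpecies G))
    (hCAN : CAN r sch) (hVS : VS r sch) (hUUVB : UUVB r sch) : UVB r sch :=
  Summit.QuantumFields.YangMills.Theorems.ContinuumLegGivenGap.stub_uvb G r sch (LSk r sch) (fun _ _ _ => rfl)
    hCAN hVS hUUVB

/-- (EUC) from (PVG) ∧ (CAN) ∧ (VS) ∧ (UUVB): route ParabolicTrajectory's landed `stub_transl : TranslOfUUVB`
(exact torus translations + seam relocation + UUVB on the sub-lattice remainder), read back on `LSk = curvDistribution`.
[folklore] -/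
theorem euc_of_pvg (r : LatticeRep G) (sch : SpeciesScheme (YMSpecies G)) (hPVG : PVG sch) (hCAN : CAN r sch)
    (hVS : VS r sch) (hUUVB : UUVB r sch) : EUC r sch := by
  intro n F hF a
  have h := Summit.QuantumFields.YangMills.Cruxes.ContinuumLimitOnTrajectory.TwoOrbitSynchronisation.stub_transl G r sch
    hPVG (uuvb_of_unfolded r sch hUUVB) n F hF a
  refine h.congr fun k => ?_
  simp only [lsk_eq_curvDistribution r sch (LSk r sch) (fun _ _ _ => rfl) hCAN hVS]

include stub_skewWindow in
/-- (NG) for any weak-coupling scheme pinned by (VS), (UVB), (ND), (CL-t): the card's window + its first lemma.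
[folklore] -/
theorem ng_of_pinned (hG : IsCompactSimpleLieGroup G) (r : LatticeRep G) (sch : SpeciesScheme (YMSpecies G))
    (hAF : Tendsto sch.β atTop atTop) (hVS : VS r sch) (hUVB : UVB r sch) (hND : ND r sch) (hCLt : CLt r sch) :
    NG r sch :=
  ng_of_skewWindow r sch (stub_skewWindow G hG r sch (LSk r sch) (fun _ _ _ => rfl) hAF hVS hUVB hND hCLt)

/-! ### §3.4 The proved dock: route ParabolicTrajectory's one-field currency -/

/-- With (CAN) ∧ (VS), `LSk` IS `curvDistribution` (landed `lsk_eq_curvDistribution`). [folklore] -/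
theorem lsk_eq (r : LatticeRep G) (sch : SpeciesScheme (YMSpecies G)) (hCAN : CAN r sch) (hVS : VS r sch)
    (k n : ℕ) (F : 𝓢((Fin n → EuclideanSpace ℝ (Fin 4)), ℂ)) : LSk r sch k n F = curvDistribution r sch k n F :=
  lsk_eq_curvDistribution r sch (LSk r sch) (fun _ _ _ => rfl) hCAN hVS k n F

/-- `curvDistribution` of a sub-scheme is `curvDistribution` along the subsequence (definitional). [folklore] -/
theorem curvDistribution_subScheme (r : LatticeRep G) (sch : SpeciesScheme (YMSpecies G)) (ψ : ℕ → ℕ)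
    (hψ : StrictMono ψ) (k n : ℕ) (F : 𝓢((Fin n → EuclideanSpace ℝ (Fin 4)), ℂ)) :
    curvDistribution r (subScheme sch ψ hψ) k n F = curvDistribution r sch (ψ k) n F :=
  rfl

/-- (CSCL) rides along subsequences (every clause of `ClustersCS` is `∀ᶠ k`). [folklore] -/
theorem hasCSClustering_canon_subScheme (r : LatticeRep G) (sch : SpeciesScheme (YMSpecies G)) (ψ : ℕ → ℕ)
    (hψ : StrictMono ψ) {Δ : ℝ} (h : SpeciesScheme.HasCSClustering r (canon r sch) Δ) :
    SpeciesScheme.HasCSClustering r (canon r (subScheme sch ψ hψ)) Δ := by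
  intro n m hn hm σ σ' N N' c c' p q hp hq t ht ε hε
  exact hψ.tendsto_atTop.eventually (h n m hn hm σ σ' N N' c c' p q hp hq t ht ε hε)

/-- (CSCL) is monotone in the rate (`e^{-Δt} ≤ e^{-Δ't}` for `Δ' ≤ Δ`, `t ≥ 0`). [folklore] -/
theorem hasCSClustering_mono (r : LatticeRep G) (sch : SpeciesScheme (YMSpecies G)) {Δ Δ' : ℝ} (hΔ : Δ' ≤ Δ)
    (h : SpeciesScheme.HasCSClustering r sch Δ) : SpeciesScheme.HasCSClustering r sch Δ' := by
  intro n m hn hm σ σ' N N' c c' p q hp hq t ht ε hε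
  refine (h n m hn hm σ σ' N N' c c' p q hp hq t ht ε hε).mono fun k hk => hk.trans ?_
  have h1 : Real.exp (-Δ * t) ≤ Real.exp (-Δ' * t) := Real.exp_le_exp.2 (by nlinarith)
  gcongr

/-- The lattice gap of the canonical scheme is that of the scheme (same `a, β, L`; definitional). [folklore] -/
theorem hasLatticeMassGap_canon_iff (r : LatticeRep G) (sch : SpeciesScheme (YMSpecies G)) (Δ : ℝ) :
    HasLatticeMassGap r (canon r sch) Δ ↔ HasLatticeMassGap r sch Δ :=
  Iff.rfl

/-- **Conversion of the UV package to route ParabolicTrajectory's currency along a sub-scheme.** For a canonically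
normalised, exactly centred scheme and ANY strictly increasing `ψ`: (UUVB) gives PT's `UVB` and `ARP` for
`subScheme sch ψ` (landed `uvb_of_uuvb`, `stub_arp`, `torusSlabRP_of_tendsto`); (ND) gives `ND2`; (UCL) gives `UCL`;
(EUC) ∧ (ROT) give `AsympEuclid` — all by `LSk = curvDistribution` and `∀ᶠ` along `ψ → ∞`. [folklore] -/
theorem pt_package_subScheme (r : LatticeRep G) (sch : SpeciesScheme (YMSpecies G)) (hAF : Tendsto sch.β atTop atTop)
    (hCAN : CAN r sch) (hVS : VS r sch) (hUUVB : UUVB r sch) (hND : ND r sch) (hUCL : UCL r sch) (hEUC : EUC r sch)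
    (hROT : ROT r sch) (ψ : ℕ → ℕ) (hψ : StrictMono ψ) :
    Summit.QuantumFields.YangMills.Cruxes.ContinuumLimitOnTrajectory.TwoOrbitSynchronisation.UVB r (subScheme sch ψ hψ) ∧ Summit.QuantumFields.YangMills.Cruxes.ContinuumLimitOnTrajectory.TwoOrbitSynchronisation.ARP r (subScheme sch ψ hψ) ∧ ND2 r (subScheme sch ψ hψ) ∧
      UCL r (subScheme sch ψ hψ) ∧ AsympEuclid r (subScheme sch ψ hψ) := by
  have hlsk := lsk_eq r sch hCAN hVS
  -- PT's UUVB for the sub-scheme: the unfolded clause along ψ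
  have hUU2 : Summit.QuantumFields.YangMills.Cruxes.ContinuumLimitOnTrajectory.TwoOrbitSynchronisation.UUVB r (subScheme sch ψ hψ) := by
    obtain ⟨s, α, β', h⟩ := hUUVB
    refine uuvb_of_unfolded r (subScheme sch ψ hψ) ⟨s, α, β', ?_⟩
    exact hψ.tendsto_atTop.eventually h
  have hUVB2 : Summit.QuantumFields.YangMills.Cruxes.ContinuumLimitOnTrajectory.TwoOrbitSynchronisation.UVB r (subScheme sch ψ hψ) :=
    Summit.QuantumFields.YangMills.Cruxes.ContinuumLimitOnTrajectory.TwoOrbitSynchronisation.uvb_of_uuvb r _ hUU2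
  have hAF2 : Tendsto (subScheme sch ψ hψ).β atTop atTop := hAF.comp hψ.tendsto_atTop
  have hARP2 : Summit.QuantumFields.YangMills.Cruxes.ContinuumLimitOnTrajectory.TwoOrbitSynchronisation.ARP r (subScheme sch ψ hψ) :=
    Summit.QuantumFields.YangMills.Cruxes.ContinuumLimitOnTrajectory.TwoOrbitSynchronisation.stub_arp G r _
      (torusSlabRP_of_tendsto r _ hAF2) hUU2 hUVB2
  refine ⟨hUVB2, hARP2, ?_, ?_, ?_, ?_⟩
  · -- ND2
    obtain ⟨f, g, H, hf, hg, hH, δ, hδ, hev⟩ := hND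
    refine ⟨f, g, H, hf, hg, hH, δ, hδ, ?_⟩
    refine (hψ.tendsto_atTop.eventually hev).mono fun k hk => ?_
    rw [curvDistribution_subScheme, ← hlsk]
    exact hk
  · -- UCL (rides along `ψ`: every clause is `∀ᶠ k`)
    intro n m F G' hF hG' a ha0 ha ε hε
    obtain ⟨t₀, ht₀⟩ := hUCL n m F G' hF hG' a ha0 ha ε hε
    refine ⟨t₀, fun t ht H hH => ?_⟩
    exact hψ.tendsto_atTop.eventually (ht₀ t ht H hH)
  · -- AsympEuclid, translation half
    intro p F hF a
    have h := (hEUC p F hF a).comp hψ.tendsto_atTop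
    refine h.congr fun k => ?_
    simp only [Function.comp_apply, curvDistribution_subScheme, hlsk]
  · -- AsympEuclid, rotation half
    intro p F hF R hR
    have h := (hROT p F hF R hR).comp hψ.tendsto_atTop
    refine h.congr fun k => ?_
    simp only [Function.comp_apply, curvDistribution_subScheme, hlsk]

/-! ### §3.5 The skeleton -/

include stub_uvPackageVol stub_csclOfLock stub_skewWindow in
/-- **`ContinuumLegGivenGap_of`** — the line's skeleton (reshape 12): `XiDiverges` (stmt-8941) BY NAME implies the crux;
every other ingredient is a registered stub or a landed theorem. See the module docstring for the composition.
[folklore] -/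
theorem ContinuumLegGivenGap_of (hXi : DirichletWindow.XiDiverges) : ConvexGribovBody.ContinuumLegGivenGap := by
  intro G _ _ _ _ hG
  letI : MeasurableSpace G := borel G
  haveI : BorelSpace G := ⟨rfl⟩
  intro hGap
  obtain ⟨r, huv⟩ := uvPackage_exists stub_uvPackageVol stub_csclOfLock hG
  obtain ⟨β, mh, S₁, K, hL⟩ := locked_of_core hXi hG r (hGap r)
  have hcrit : Tendsto mh atTop (𝓝 0) :=
    Summit.QuantumFields.YangMills.Theorems.ContinuumLegGivenGap.stub_critical
      hXi G hG r (hGap r) β mh S₁ hL.1 hL.2.1 hL.2.2.2.1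
  obtain ⟨sch, φ, Δ₀, hφ, hβ, hΔ₀, ha, hLk, hVS, hCAN, hUUVB, hND, hCLt, hUCL, hPVG, hROT, Δ₁, hΔ₁, hCS⟩ :=
    huv hL hcrit
  have hEUC : EUC r sch := euc_of_pvg r sch hPVG hCAN hVS hUUVB
  have hAF : Tendsto sch.β atTop atTop := by
    have hcomp : sch.β = fun k => β (φ k) := funext hβ
    rw [hcomp]
    exact hL.1.comp hφ.tendsto_atTop
  have hUVB : UVB r sch := uvb_of_uuvb r sch hCAN hVS hUUVB
  have hGAP : HasLatticeMassGap r sch Δ₀ := gap_of_locked r hL hβ ha hLk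
  -- the card: skewness floor frequently; extract a sub-scheme inside that set with convergent products
  obtain ⟨f₃, g₃, h₃, F₃, hT₃, hO₃, δ, hδ, hfreq⟩ := ng_of_pinned stub_skewWindow hG r sch hAF hVS hUVB hND hCLt
  obtain ⟨ψ, hψ, hψS, hconv⟩ :=
    stub_extract G r sch hUUVB {k | δ ≤ ‖LSk r sch k 3 F₃‖} hfreq
  set sch₂ : SpeciesScheme (YMSpecies G) := subScheme sch ψ hψ with hsch₂
  obtain ⟨hUVB2, hARP2, hND2, hUCL2, hE1⟩ := pt_package_subScheme r sch hAF hCAN hVS hUUVB hND hUCL hEUC hROT ψ hψ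
  have hND3 : ND3 r sch₂ := by
    refine ⟨f₃, g₃, h₃, F₃, hT₃, hO₃, δ, hδ, Eventually.of_forall fun k => ?_⟩
    rw [hsch₂, curvDistribution_subScheme, ← lsk_eq r sch hCAN hVS]
    exact hψS k
  -- the proved one-field OS packaging
  obtain ⟨T, hYM, hNT, hNGT⟩ := oneFieldOSLegs' G r sch₂ hconv hUVB2 hE1 hARP2 hUCL2 hND2 hND3
  -- the two gaps at the common rate
  set Δ : ℝ := min Δ₀ Δ₁ with hΔdef
  have hΔ : 0 < Δ := lt_min hΔ₀ hΔ₁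
  have hLG : HasLatticeMassGap r (canon r sch₂) Δ :=
    (hasLatticeMassGap_canon_iff r sch₂ Δ).2
      (hasLatticeMassGap_mono r sch₂ (min_le_left _ _) (hasLatticeMassGap_subScheme hGAP ψ hψ))
  have hCS2 : SpeciesScheme.HasCSClustering r (canon r sch₂) Δ :=
    hasCSClustering_mono r _ (min_le_right _ _) (hasCSClustering_canon_subScheme r sch ψ hψ hCS)
  have hMG : T.HasMassGap Δ := hYM.hasMassGap_of_hasCSClustering hCS2
  refine ⟨r, canon r sch₂, T, ?_, hYM, hNT, hNGT, Δ, hΔ, hMG, hLG⟩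
  show Tendsto (canon r sch₂).β atTop atTop
  exact hAF.comp hψ.tendsto_atTop

include stub_uvPackageVol stub_csclOfLock stub_skewWindow in
/-- The shared item's other declarations follow verbatim. [folklore] -/
theorem SmallCircleAnchor_ContinuumLegGivenGap_of (hXi : DirichletWindow.XiDiverges) :
    SmallCircleAnchor.ContinuumLegGivenGap :=
  smallCircleAnchor_iff.2 (ContinuumLegGivenGap_of stub_uvPackageVol stub_csclOfLock stub_skewWindow hXi)

include stub_uvPackageVol stub_csclOfLock stub_skewWindow in
/-- (ditto) [folklore] -/
theorem HyperbolicRegulator_ContinuumLegGivenGap_of (hXi : DirichletWindow.XiDiverges) :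
    HyperbolicRegulator.ContinuumLegGivenGap :=
  hyperbolicRegulator_iff.2 (ContinuumLegGivenGap_of stub_uvPackageVol stub_csclOfLock stub_skewWindow hXi)

include stub_uvPackageVol stub_csclOfLock stub_skewWindow in
/-- (ditto) [folklore] -/
theorem ContractibleFibre_WeakCouplingContinuumLeg_of (hXi : DirichletWindow.XiDiverges) :
    ContractibleFibre.WeakCouplingContinuumLeg :=
  contractibleFibre_iff.2 (ContinuumLegGivenGap_of stub_uvPackageVol stub_csclOfLock stub_skewWindow hXi)


/-! ## §4 The split, hypotheses verbatim (order: XiDiverges, UV engine, skewness window, CS glue) -/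

/-- **`ContinuumLegGivenGap_of_subs`** — the typed split of the shared crux stmt-QuantumFields-15828 for route
`ComplexCouplingChannel`: criticality `XiDiverges` (stmt-8941), the volume-uniform UV engine (`stub_uvPackageVol`
verbatim), the NLO skewness window (`stub_skewWindow` verbatim) and the Cauchy–Schwarz clustering glue
(`stub_csclOfLock` verbatim, provable) imply the crux. Pure composition over landed theorems. [folklore] -/
theorem ContinuumLegGivenGap_of_subs :
    DirichletWindow.XiDiverges →
    (∀ (G : Type) [Group G] [TopologicalSpace G] [IsTopologicalGroup G] [CompactSpace G] [MeasurableSpace G] [BorelSpace G], IsCompactSimpleLieGroup G → ∃ r : LatticeRep G, ∀ (β : ℕ → ℝ) (mh : ℕ → ℝ) (S₁ : ℕ → ℕ) (K : ℝ), Tendsto β atTop atTop → (∀ k, 0 < mh k) → 0 < K → (∀ A B : YMSpecies G, ∃ C : ℝ, ∀ k S n : ℕ, S₁ k ≤ S → n ≤ S → |latticeConnectedCorr r.ρ (β k) (2 * S + 1) A.F B.F n| ≤ C * Real.exp (-(mh k * n))) → (∀ k S₀ : ℕ, ∃ A B : YMSpecies G, ∀ C : ℝ, ∃ S n : ℕ,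 S₀ ≤ S ∧ n ≤ S ∧ C * Real.exp (-(K * mh k * n)) < |latticeConnectedCorr r.ρ (β k) (2 * S + 1) A.F B.F n|) → Tendsto mh atTop (𝓝 0) → ∃ (a : ℕ → ℝ) (φ : ℕ → ℕ) (Δ₀ : ℝ) (𝓛 : ℕ → Set ℕ), (∀ k, 0 < a k) ∧ StrictMono φ ∧ 0 < Δ₀ ∧ (∀ k, Δ₀ * a k ≤ mh (φ k)) ∧ (∀ k S : ℕ, ∃ S' : ℕ, S' ∈ 𝓛 k ∧ S ≤ S') ∧ (∀ k : ℕ, ∀ S ∈ 𝓛 k, S₁ (φ k) ≤ S) ∧ (∃ N : ℕ, 1 ≤ N ∧ ∀ᶠ k in atTop, ∀ S ∈ 𝓛 k, (a k)⁻¹ ≤ (a k * (S : ℝ)) ^ N) ∧ ∀ (sch : SpeciesScheme (YMSpecies G)), (∀ k, sch.a k = a k) → (∀ k, sch.β k = β (φ k)) → (∀ k, sch.L k ∈ 𝓛 k) → ∀ (LS : (k n : ℕ) → SchwartzMap (Fin n → EuclideanSpace ℝ (Fin 4)) ℂ → ℂ), (∀ (k n : ℕ) (F : SchwartzMap (Fin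 n → EuclideanSpace ℝ (Fin 4)) ℂ), LS k n F = ∫ U : GaugeConfig 4 (sch.side k) G, ∑ x : Fin n → ↥(Literature.Probability.LatticeModels.box 4 (sch.L k)), F (fun i => sch.a k • siteToE ↑(x i)) * ∏ i, ((sch.c r.curvature k * sch.a k ^ 4 * (r.curvature.F (Literature.MathematicalPhysics.QuantumLattice.configShift (-↑(x i)) (Literature.MathematicalPhysics.QuantumLattice.torusLift (sch.side k) U)) - sch.m r.curvature k) : ℝ) : ℂ) ∂(wilsonMeasure r.ρ (sch.β k))) → (∀ k : ℕ, sch.m r.curvature k = ∫ U : GaugeConfig 4 (sch.side k) G, r.curvature.F (Literature.MathematicalPhysics.QuantumLattice.torusLift (sch.side k) U) ∂(wilsonMeasure r.ρ (sch.β k))) → (∀ k : ℕ, sch.c r.curvature k = (sch.a k ^ 4)⁻¹) → (∃ (s : ℕ) (α β' : ℝ), ∀ᶠ k in atTop, ∀ (p : ℕ) (q : Fin p → {q : Fin 4 × Fin 4 // q.1 < q.2}) (F : SchwartzMap (Fin p → EuclideanSpace ℝ (Fin 4)) ℂ), IsOffDiagonal F → ‖∫ U : GaugeConfig 4 (sch.side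 k) G, ∑ x : Fin p → ↥(Literature.Probability.LatticeModels.box 4 (sch.L k)), F (fun i => sch.a k • siteToE ↑(x i)) * ∏ i, ((plaquetteObs r.ρ 0 (q i).1.1 (q i).1.2 (Literature.MathematicalPhysics.QuantumLattice.configShift (-↑(x i)) (Literature.MathematicalPhysics.QuantumLattice.torusLift (sch.side k) U)) - wilsonTorusMean r.ρ (sch.β k) (sch.L k) (plaquetteObs r.ρ 0 (q i).1.1 (q i).1.2) : ℝ) : ℂ) ∂(wilsonMeasure r.ρ (sch.β k))‖ ≤ α * (p.factorial : ℝ) ^ β' * schwartzNorm (p * s) F) ∧ (∃ (f g : SchwartzMap (Fin 1 → EuclideanSpace ℝ (Fin 4)) ℂ) (H : SchwartzMap (Fin (1 + 1) → EuclideanSpace ℝ (Fin 4)) ℂ), IsTimeOrdered f ∧ IsTimeOrdered g ∧ IsAppendTensorOf H (osAdjoint f) g ∧ ∃ δ : ℝ, 0 < δ ∧ ∀ᶠ k in atTop, δ ≤ ‖LS k (1 + 1) H‖) ∧ (∀ R : EuclideanSpace ℝ (Fin 4) ≃ₗᵢ[ℝ] EuclideanSpace ℝ (Fin 4), R (EuclideanSpace.single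 0 1) = (3 / 5 : ℝ) • EuclideanSpace.single 0 1 + (-(4 / 5) : ℝ) • EuclideanSpace.single 1 1 → R (EuclideanSpace.single 1 1) = (4 / 5 : ℝ) • EuclideanSpace.single 0 1 + (3 / 5 : ℝ) • EuclideanSpace.single 1 1 → R (EuclideanSpace.single 2 1) = EuclideanSpace.single 2 1 → R (EuclideanSpace.single 3 1) = EuclideanSpace.single 3 1 → ∀ (n : ℕ) (F : SchwartzMap (Fin n → EuclideanSpace ℝ (Fin 4)) ℂ), IsOffDiagonal F → Tendsto (fun k : ℕ => LS k n (linActMulti R F) - LS k n F) atTop (𝓝 0))) →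
    (∀ (G : Type) [Group G] [TopologicalSpace G] [IsTopologicalGroup G] [CompactSpace G] [MeasurableSpace G] [BorelSpace G], IsCompactSimpleLieGroup G → ∀ (r : LatticeRep G) (sch : SpeciesScheme (YMSpecies G)) (LS : (k n : ℕ) → SchwartzMap (Fin n → EuclideanSpace ℝ (Fin 4)) ℂ → ℂ), (∀ (k n : ℕ) (F : SchwartzMap (Fin n → EuclideanSpace ℝ (Fin 4)) ℂ), LS k n F = ∫ U : GaugeConfig 4 (sch.side k) G, ∑ x : Fin n → ↥(box 4 (sch.L k)), F (fun i => sch.a k • siteToE ↑(x i)) * ∏ i, ((sch.c r.curvature k * sch.a k ^ 4 * (r.curvature.F (configShift (-↑(x i)) (torusLift (sch.side k) U)) - sch.m r.curvature k) : ℝ) : ℂ) ∂(wilsonMeasure r.ρ (sch.β k))) → Tendsto sch.β atTop atTop → (∀ k : ℕ, sch.m r.curvature k = ∫ U : GaugeConfig 4 (sch.side k) G, r.curvature.F (torusLift (sch.side k) U) ∂(wilsonMeasure r.ρ (sch.β k))) → (∃ (s : ℕ) (α β' : ℝ), ∀ (n : ℕ) (F : SchwartzMap (Fin n → EuclideanSpace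 ℝ (Fin 4)) ℂ), IsOffDiagonal F → ∀ᶠ k in atTop, ‖LS k n F‖ ≤ α * (n.factorial : ℝ) ^ β' * schwartzNorm (n * s) F) → (∃ (f g : SchwartzMap (Fin 1 → EuclideanSpace ℝ (Fin 4)) ℂ) (H : SchwartzMap (Fin (1 + 1) → EuclideanSpace ℝ (Fin 4)) ℂ), IsTimeOrdered f ∧ IsTimeOrdered g ∧ IsAppendTensorOf H (osAdjoint f) g ∧ ∃ δ : ℝ, 0 < δ ∧ ∀ᶠ k in atTop, δ ≤ ‖LS k (1 + 1) H‖) → (∃ Δ : ℝ, 0 < Δ ∧ ∀ (n m : ℕ) (F : SchwartzMap (Fin n → EuclideanSpace ℝ (Fin 4)) ℂ) (G' : SchwartzMap (Fin m → EuclideanSpace ℝ (Fin 4)) ℂ), IsTimeOrdered F → IsTimeOrdered G' → ∃ C : ℝ, ∀ t : ℝ, 0 ≤ t → ∀ᶠ k in atTop, ∀ H : SchwartzMap (Fin (n + m) → EuclideanSpace ℝ (Fin 4)) ℂ, IsAppendTensorOf H (osAdjoint F) (translateMulti (EuclideanSpace.single 0 t) G') → ‖LS k (n + m) H - LS k n (osAdjoint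 F) * LS k m G'‖ ≤ C * Real.exp (-Δ * t)) → ∃ (s₃ : ℂ) (φ : ℕ → ℕ) (f g h : ℕ → SchwartzMap (EuclideanSpace ℝ (Fin 4)) ℂ) (F₃ : ℕ → SchwartzMap (Fin 3 → EuclideanSpace ℝ (Fin 4)) ℂ) (w : ℕ → ℝ), s₃ ≠ 0 ∧ StrictMono φ ∧ (∀ j, 0 < w j) ∧ (∀ j, IsTensorOf (F₃ j) ![f j, g j, h j] ∧ IsOffDiagonal (F₃ j)) ∧ ∀ ε : ℝ, 0 < ε → ∀ᶠ j in atTop, ∀ᶠ k in atTop, ‖LS (φ k) 3 (F₃ j) / (w j : ℂ) - s₃‖ ≤ ε) →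
    (∀ (G : Type) [Group G] [TopologicalSpace G] [IsTopologicalGroup G] [CompactSpace G] [MeasurableSpace G] [BorelSpace G] (r : LatticeRep G) (β mh : ℕ → ℝ) (S₁ : ℕ → ℕ) (a : ℕ → ℝ) (φ : ℕ → ℕ) (Δ₀ : ℝ) (𝓛 : ℕ → Set ℕ), Tendsto β atTop atTop → (∀ k, 0 < mh k) → (∀ A B : YMSpecies G, ∃ C : ℝ, ∀ k S n : ℕ, S₁ k ≤ S → n ≤ S → |latticeConnectedCorr r.ρ (β k) (2 * S + 1) A.F B.F n| ≤ C * Real.exp (-(mh k * n))) → (∀ k, 0 < a k) → StrictMono φ → 0 < Δ₀ → (∀ k, Δ₀ * a k ≤ mh (φ k)) → Tendsto mh atTop (𝓝 0) → (∀ k S : ℕ, ∃ S' : ℕ, S' ∈ 𝓛 k ∧ S ≤ S') → (∀ k : ℕ, ∀ S ∈ 𝓛 k, S₁ (φ k) ≤ S) → (∃ N : ℕ, 1 ≤ N ∧ ∀ᶠ k in atTop, ∀ S ∈ 𝓛 k, (a k)⁻¹ ≤ (a k * (S : ℝ)) ^ N) → (∀ (sch : SpeciesScheme (YMSpecies G)),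 (∀ k, sch.a k = a k) → (∀ k, sch.β k = β (φ k)) → (∀ k, sch.L k ∈ 𝓛 k) → (∀ k : ℕ, sch.m r.curvature k = ∫ U : GaugeConfig 4 (sch.side k) G, r.curvature.F (torusLift (sch.side k) U) ∂(wilsonMeasure r.ρ (sch.β k))) → (∀ k : ℕ, sch.c r.curvature k = (sch.a k ^ 4)⁻¹) → (∃ (s : ℕ) (α β' : ℝ), ∀ᶠ k in atTop, ∀ (p : ℕ) (q : Fin p → {q : Fin 4 × Fin 4 // q.1 < q.2}) (F : SchwartzMap (Fin p → EuclideanSpace ℝ (Fin 4)) ℂ), IsOffDiagonal F → ‖∫ U : GaugeConfig 4 (sch.side k) G, ∑ x : Fin p → ↥(box 4 (sch.L k)), F (fun i => sch.a k • siteToE ↑(x i)) * ∏ i, ((plaquetteObs r.ρ 0 (q i).1.1 (q i).1.2 (configShift (-↑(x i)) (torusLift (sch.side k) U)) - wilsonTorusMean r.ρ (sch.β k) (sch.L k) (plaquetteObs r.ρ 0 (q i).1.1 (q i).1.2) : ℝ) : ℂ) ∂(wilsonMeasure r.ρ (sch.β k))‖ ≤ α * (p.factorial : ℝ) ^ β'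 * schwartzNorm (p * s) F)) → ∃ sch : SpeciesScheme (YMSpecies G), (∀ k, sch.a k = a k) ∧ (∀ k, sch.β k = β (φ k)) ∧ (∀ k, sch.L k ∈ 𝓛 k) ∧ (∀ k : ℕ, sch.c r.curvature k = (sch.a k ^ 4)⁻¹) ∧ (∀ k : ℕ, sch.m r.curvature k = ∫ U : GaugeConfig 4 (sch.side k) G, r.curvature.F (torusLift (sch.side k) U) ∂(wilsonMeasure r.ρ (sch.β k))) ∧ ∃ Δ₁ : ℝ, 0 < Δ₁ ∧ SpeciesScheme.HasCSClustering r (canon r sch) Δ₁) →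
    HyperbolicRegulator.ContinuumLegGivenGap :=
  fun hXi hUV' hSk' hCSL' => hyperbolicRegulator_iff.2 (ContinuumLegGivenGap_of hUV' hCSL' hSk' hXi)

/-- The same split for the other five declarations of the shared item. [folklore] -/
theorem ContinuumLegGivenGap_of_subs_twins :
    DirichletWindow.XiDiverges →
    (∀ (G : Type) [Group G] [TopologicalSpace G] [IsTopologicalGroup G] [CompactSpace G] [MeasurableSpace G] [BorelSpace G], IsCompactSimpleLieGroup G → ∃ r : LatticeRep G, ∀ (β : ℕ → ℝ) (mh : ℕ → ℝ) (S₁ : ℕ → ℕ) (K : ℝ), Tendsto β atTop atTop → (∀ k, 0 < mh k) → 0 < K → (∀ A B : YMSpecies G, ∃ C : ℝ, ∀ k S n : ℕ, S₁ k ≤ S → n ≤ S → |latticeConnectedCorr r.ρ (β k) (2 * S + 1) A.F B.F n| ≤ C * Real.exp (-(mh k * n))) → (∀ k S₀ : ℕ, ∃ A B : YMSpecies G, ∀ C : ℝ, ∃ S n : ℕ, S₀ ≤ S ∧ n ≤ S ∧ C * Real.exp (-(K * mh k * n)) < |latticeConnectedCorr r.ρ (β k) (2 * S + 1) A.F B.F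 n|) → Tendsto mh atTop (𝓝 0) → ∃ (a : ℕ → ℝ) (φ : ℕ → ℕ) (Δ₀ : ℝ) (𝓛 : ℕ → Set ℕ), (∀ k, 0 < a k) ∧ StrictMono φ ∧ 0 < Δ₀ ∧ (∀ k, Δ₀ * a k ≤ mh (φ k)) ∧ (∀ k S : ℕ, ∃ S' : ℕ, S' ∈ 𝓛 k ∧ S ≤ S') ∧ (∀ k : ℕ, ∀ S ∈ 𝓛 k, S₁ (φ k) ≤ S) ∧ (∃ N : ℕ, 1 ≤ N ∧ ∀ᶠ k in atTop, ∀ S ∈ 𝓛 k, (a k)⁻¹ ≤ (a k * (S : ℝ)) ^ N) ∧ ∀ (sch : SpeciesScheme (YMSpecies G)), (∀ k, sch.a k = a k) → (∀ k, sch.β k = β (φ k)) → (∀ k, sch.L k ∈ 𝓛 k) → ∀ (LS : (k n : ℕ) → SchwartzMap (Fin n → EuclideanSpace ℝ (Fin 4)) ℂ → ℂ), (∀ (k n : ℕ) (F : SchwartzMap (Fin n → EuclideanSpace ℝ (Fin 4)) ℂ), LS k n F = ∫ U : GaugeConfig 4 (sch.side k) G, ∑ x : Fin n → ↥(Literature.Probability.LatticeModels.box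 4 (sch.L k)), F (fun i => sch.a k • siteToE ↑(x i)) * ∏ i, ((sch.c r.curvature k * sch.a k ^ 4 * (r.curvature.F (Literature.MathematicalPhysics.QuantumLattice.configShift (-↑(x i)) (Literature.MathematicalPhysics.QuantumLattice.torusLift (sch.side k) U)) - sch.m r.curvature k) : ℝ) : ℂ) ∂(wilsonMeasure r.ρ (sch.β k))) → (∀ k : ℕ, sch.m r.curvature k = ∫ U : GaugeConfig 4 (sch.side k) G, r.curvature.F (Literature.MathematicalPhysics.QuantumLattice.torusLift (sch.side k) U) ∂(wilsonMeasure r.ρ (sch.β k))) → (∀ k : ℕ, sch.c r.curvature k = (sch.a k ^ 4)⁻¹) → (∃ (s : ℕ) (α β' : ℝ), ∀ᶠ k in atTop, ∀ (p : ℕ) (q : Fin p → {q : Fin 4 × Fin 4 // q.1 < q.2}) (F : SchwartzMap (Fin p → EuclideanSpace ℝ (Fin 4)) ℂ), IsOffDiagonal F → ‖∫ U : GaugeConfig 4 (sch.side k) G, ∑ x : Fin p → ↥(Literature.Probability.LatticeModels.box 4 (sch.L k)), F (fun i => sch.a k • siteToE ↑(x i)) * ∏ i, ((plaquetteObs r.ρ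 0 (q i).1.1 (q i).1.2 (Literature.MathematicalPhysics.QuantumLattice.configShift (-↑(x i)) (Literature.MathematicalPhysics.QuantumLattice.torusLift (sch.side k) U)) - wilsonTorusMean r.ρ (sch.β k) (sch.L k) (plaquetteObs r.ρ 0 (q i).1.1 (q i).1.2) : ℝ) : ℂ) ∂(wilsonMeasure r.ρ (sch.β k))‖ ≤ α * (p.factorial : ℝ) ^ β' * schwartzNorm (p * s) F) ∧ (∃ (f g : SchwartzMap (Fin 1 → EuclideanSpace ℝ (Fin 4)) ℂ) (H : SchwartzMap (Fin (1 + 1) → EuclideanSpace ℝ (Fin 4)) ℂ), IsTimeOrdered f ∧ IsTimeOrdered g ∧ IsAppendTensorOf H (osAdjoint f) g ∧ ∃ δ : ℝ, 0 < δ ∧ ∀ᶠ k in atTop, δ ≤ ‖LS k (1 + 1) H‖) ∧ (∀ R : EuclideanSpace ℝ (Fin 4) ≃ₗᵢ[ℝ] EuclideanSpace ℝ (Fin 4), R (EuclideanSpace.single 0 1) = (3 / 5 : ℝ) • EuclideanSpace.single 0 1 + (-(4 / 5) : ℝ) • EuclideanSpace.single 1 1 → R (EuclideanSpace.single 1 1)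 = (4 / 5 : ℝ) • EuclideanSpace.single 0 1 + (3 / 5 : ℝ) • EuclideanSpace.single 1 1 → R (EuclideanSpace.single 2 1) = EuclideanSpace.single 2 1 → R (EuclideanSpace.single 3 1) = EuclideanSpace.single 3 1 → ∀ (n : ℕ) (F : SchwartzMap (Fin n → EuclideanSpace ℝ (Fin 4)) ℂ), IsOffDiagonal F → Tendsto (fun k : ℕ => LS k n (linActMulti R F) - LS k n F) atTop (𝓝 0))) →
    (∀ (G : Type) [Group G] [TopologicalSpace G] [IsTopologicalGroup G] [CompactSpace G] [MeasurableSpace G] [BorelSpace G], IsCompactSimpleLieGroup G → ∀ (r : LatticeRep G) (sch : SpeciesScheme (YMSpecies G)) (LS : (k n : ℕ) → SchwartzMap (Fin n → EuclideanSpace ℝ (Fin 4)) ℂ → ℂ), (∀ (k n : ℕ) (F : SchwartzMap (Fin n → EuclideanSpace ℝ (Fin 4)) ℂ), LS k n F = ∫ U : GaugeConfig 4 (sch.side k) G, ∑ x : Fin n → ↥(box 4 (sch.L k)), F (fun i => sch.a k • siteToE ↑(x i)) * ∏ i, ((sch.c r.curvature k * sch.a k ^ 4 * (r.curvature.F (configShift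 (-↑(x i)) (torusLift (sch.side k) U)) - sch.m r.curvature k) : ℝ) : ℂ) ∂(wilsonMeasure r.ρ (sch.β k))) → Tendsto sch.β atTop atTop → (∀ k : ℕ, sch.m r.curvature k = ∫ U : GaugeConfig 4 (sch.side k) G, r.curvature.F (torusLift (sch.side k) U) ∂(wilsonMeasure r.ρ (sch.β k))) → (∃ (s : ℕ) (α β' : ℝ), ∀ (n : ℕ) (F : SchwartzMap (Fin n → EuclideanSpace ℝ (Fin 4)) ℂ), IsOffDiagonal F → ∀ᶠ k in atTop, ‖LS k n F‖ ≤ α * (n.factorial : ℝ) ^ β' * schwartzNorm (n * s) F) → (∃ (f g : SchwartzMap (Fin 1 → EuclideanSpace ℝ (Fin 4)) ℂ) (H : SchwartzMap (Fin (1 + 1) → EuclideanSpace ℝ (Fin 4)) ℂ), IsTimeOrdered f ∧ IsTimeOrdered g ∧ IsAppendTensorOf H (osAdjoint f) g ∧ ∃ δ : ℝ, 0 < δ ∧ ∀ᶠ k in atTop, δ ≤ ‖LS k (1 + 1) H‖) → (∃ Δ : ℝ, 0 < Δ ∧ ∀ (n m : ℕ) (F : SchwartzMap (Fin n → EuclideanSpace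 ℝ (Fin 4)) ℂ) (G' : SchwartzMap (Fin m → EuclideanSpace ℝ (Fin 4)) ℂ), IsTimeOrdered F → IsTimeOrdered G' → ∃ C : ℝ, ∀ t : ℝ, 0 ≤ t → ∀ᶠ k in atTop, ∀ H : SchwartzMap (Fin (n + m) → EuclideanSpace ℝ (Fin 4)) ℂ, IsAppendTensorOf H (osAdjoint F) (translateMulti (EuclideanSpace.single 0 t) G') → ‖LS k (n + m) H - LS k n (osAdjoint F) * LS k m G'‖ ≤ C * Real.exp (-Δ * t)) → ∃ (s₃ : ℂ) (φ : ℕ → ℕ) (f g h : ℕ → SchwartzMap (EuclideanSpace ℝ (Fin 4)) ℂ) (F₃ : ℕ → SchwartzMap (Fin 3 → EuclideanSpace ℝ (Fin 4)) ℂ) (w : ℕ → ℝ), s₃ ≠ 0 ∧ StrictMono φ ∧ (∀ j, 0 < w j) ∧ (∀ j, IsTensorOf (F₃ j) ![f j, g j, h j] ∧ IsOffDiagonal (F₃ j)) ∧ ∀ ε : ℝ, 0 < ε → ∀ᶠ j in atTop, ∀ᶠ k in atTop, ‖LS (φ k) 3 (F₃ j) / (w j : ℂ) - s₃‖ ≤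 ε) →
    (∀ (G : Type) [Group G] [TopologicalSpace G] [IsTopologicalGroup G] [CompactSpace G] [MeasurableSpace G] [BorelSpace G] (r : LatticeRep G) (β mh : ℕ → ℝ) (S₁ : ℕ → ℕ) (a : ℕ → ℝ) (φ : ℕ → ℕ) (Δ₀ : ℝ) (𝓛 : ℕ → Set ℕ), Tendsto β atTop atTop → (∀ k, 0 < mh k) → (∀ A B : YMSpecies G, ∃ C : ℝ, ∀ k S n : ℕ, S₁ k ≤ S → n ≤ S → |latticeConnectedCorr r.ρ (β k) (2 * S + 1) A.F B.F n| ≤ C * Real.exp (-(mh k * n))) → (∀ k, 0 < a k) → StrictMono φ → 0 < Δ₀ → (∀ k, Δ₀ * a k ≤ mh (φ k)) → Tendsto mh atTop (𝓝 0) → (∀ k S : ℕ, ∃ S' : ℕ, S' ∈ 𝓛 k ∧ S ≤ S') → (∀ k : ℕ, ∀ S ∈ 𝓛 k, S₁ (φ k) ≤ S) → (∃ N : ℕ, 1 ≤ N ∧ ∀ᶠ k in atTop, ∀ S ∈ 𝓛 k, (a k)⁻¹ ≤ (a k * (S : ℝ)) ^ N) → (∀ (sch : SpeciesScheme (YMSpecies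 G)), (∀ k, sch.a k = a k) → (∀ k, sch.β k = β (φ k)) → (∀ k, sch.L k ∈ 𝓛 k) → (∀ k : ℕ, sch.m r.curvature k = ∫ U : GaugeConfig 4 (sch.side k) G, r.curvature.F (torusLift (sch.side k) U) ∂(wilsonMeasure r.ρ (sch.β k))) → (∀ k : ℕ, sch.c r.curvature k = (sch.a k ^ 4)⁻¹) → (∃ (s : ℕ) (α β' : ℝ), ∀ᶠ k in atTop, ∀ (p : ℕ) (q : Fin p → {q : Fin 4 × Fin 4 // q.1 < q.2}) (F : SchwartzMap (Fin p → EuclideanSpace ℝ (Fin 4)) ℂ), IsOffDiagonal F → ‖∫ U : GaugeConfig 4 (sch.side k) G, ∑ x : Fin p → ↥(box 4 (sch.L k)), F (fun i => sch.a k • siteToE ↑(x i)) * ∏ i, ((plaquetteObs r.ρ 0 (q i).1.1 (q i).1.2 (configShift (-↑(x i)) (torusLift (sch.side k) U)) - wilsonTorusMean r.ρ (sch.β k) (sch.L k) (plaquetteObs r.ρ 0 (q i).1.1 (q i).1.2) : ℝ) : ℂ) ∂(wilsonMeasure r.ρ (sch.β k))‖ ≤ α * (p.factorial : ℝ) ^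 β' * schwartzNorm (p * s) F)) → ∃ sch : SpeciesScheme (YMSpecies G), (∀ k, sch.a k = a k) ∧ (∀ k, sch.β k = β (φ k)) ∧ (∀ k, sch.L k ∈ 𝓛 k) ∧ (∀ k : ℕ, sch.c r.curvature k = (sch.a k ^ 4)⁻¹) ∧ (∀ k : ℕ, sch.m r.curvature k = ∫ U : GaugeConfig 4 (sch.side k) G, r.curvature.F (torusLift (sch.side k) U) ∂(wilsonMeasure r.ρ (sch.β k))) ∧ ∃ Δ₁ : ℝ, 0 < Δ₁ ∧ SpeciesScheme.HasCSClustering r (canon r sch) Δ₁) →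
    ConvexGribovBody.ContinuumLegGivenGap ∧ SmallCircleAnchor.ContinuumLegGivenGap ∧
      ContractibleFibre.WeakCouplingContinuumLeg :=
  fun hXi hUV' hSk' hCSL' =>
    ⟨ContinuumLegGivenGap_of hUV' hCSL' hSk' hXi, ContinuumLegGivenGap_of hUV' hCSL' hSk' hXi,
      ContinuumLegGivenGap_of hUV' hCSL' hSk' hXi⟩

end Summit.QuantumFields.YangMills.Theorems.ContinuumLegGivenGapSplit

end
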